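import Summits.CriticalPhenomena.PercolationContinuityZ3.Theorems.PercNearOneGluingNoHeavyQuantAtomLaw
import Summits.CriticalPhenomena.PercolationContinuityZ3.Theorems.PercNearOneGluingNoHeavyQuantConvHeavy
import HarnessLib

/-!
# QUANT lane R8, T-DEC: THE LIGHT SLICE OF A TYPE I ATOM IS CENSUS-1's SIX-CELL LAW (census-2 g58) — the bridge between `LightSliceCore`
# (explicit atoms) and census-1 g22's `lsLaw_decAtT_of_flow` / LS-CORE cells (`…QuantLSCoreFlow`, `…QuantLSCoreMMG…`)

builds on p205010 (kernel theorem, internal audit signed; external expert review pending)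

Support file (`--supports stmt-CriticalPhenomena-4575`), QUANT lane seat prim-quant-census-2 (gen 58), rung R8 of
`run/shared/lean/prim/quant/LADDER.md`.  Theorems only, standard axioms, no sorries.  Memo `…/prim-quant-census-2-g58/EXTREME-ATOMS-G58.md` §3.

* `atomLaw_apply_typeI` — the three values of a Type I atom `atomLaw x T j l h l′ h`; `atomLaw_typeI_masses` — tails `1 − x`, absorber `x`.
* `shift_atomLaw_typeI` — a shifted Type I atom on its three cells.
* **`lightSlice_typeI_eq_sixCell`** — `lconv M₁ M₂ (TP[p,m;γ]) (atomLaw x T₂ j l h l′ h)` is the six-cell law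
  `(1−γ)m_l δ_{p+l} + (1−γ)m_{l′} δ_{p+l′} + (1−γ)m_h δ_{p+h} + γm_l δ_{m+l} + γm_{l′} δ_{m+l′} + γm_h δ_{m+h}` — census-1's `c₁, c₂, c_P, d₁, d₂, d_G`
  with `m_l = (1−x)λ`, `m_{l′} = (1−x)λ′`, `m_h = x`.  With it the Type I instances of `LightSliceCore` (`…QuantLightSliceCore`) are literally the
  conclusions of census-1's six-cell theorems.

[this work]; nothing here is cited as a published result.  The gluing rows served [cite: KozmaNitzan2024, Conjecture 3 (p. 15)]; product
measure [cite: Grimmett1999, §1.3 p. 10].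
-/

noncomputable section

namespace Summit.CriticalPhenomena.PercolationContinuityZ3.Theorems

namespace Quant

open Finset

/-- the two-point law `{lo, hi; g}` (as in `…QuantLawDEC`) -/
local notation3 "TP[" lo ", " hi ", " g ", " h "]" =>
  (g : ℝ) * (if (h : ℕ) = (hi : ℕ) then (1 : ℝ) else 0) + (1 - (g : ℝ)) * (if (h : ℕ) = (lo : ℕ) then (1 : ℝ) else 0)

/-- the shifted law `μ(· − s)` (as in `…QuantConvTopDatum`) -/
local notation3 "SH[" μ ", " s ", " h "]" => (if (s : ℕ) ≤ (h : ℕ) then (μ : ℕ → ℝ) ((h : ℕ) - (s : ℕ)) else (0 : ℝ))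

namespace LawDec

/-- indicator of equality of naturals, as a real number -/
local notation3 "𝟙[" a ", " b "]" => (if (a : ℕ) = (b : ℕ) then (1 : ℝ) else 0)

/-! ### The light slice of a Type I atom is census-1's six-cell law -/

/-- the values of a Type I atom (`h₁ = h₂ = h`) at its three positions. -/
theorem atomLaw_apply_typeI (x T : ℝ) (j l h l' : ℕ) (hl : l ≠ l') (hlh : l ≠ h) (hl'h : l' ≠ h) :
    atomLaw x T j l h l' h l = (1 - x) / (usage x T j l h - usage x T j l' h) * (x / (1 - x) - usage x T j l' h) ∧
    atomLaw x T j l h l' h l' = (1 - x) / (usage x T j l h - usage x T j l' h) * (usage x T j l h - x / (1 - x)) ∧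
    atomLaw x T j l h l' h h = (1 - x) / (usage x T j l h - usage x T j l' h) *
      ((x / (1 - x) - usage x T j l' h) * usage x T j l h + (usage x T j l h - x / (1 - x)) * usage x T j l' h) := by
  unfold atomLaw
  refine ⟨?_, ?_, ?_⟩
  · rw [if_pos rfl, if_neg hlh, if_neg hl]; ring
  · rw [if_neg (Ne.symm hl), if_neg hl'h, if_pos rfl]; ring
  · rw [if_neg (Ne.symm hlh), if_pos rfl, if_neg (Ne.symm hl'h)]; ring

/-- a shift of a Type I atom, written on its three cells. -/
theorem shift_atomLaw_typeI (x T : ℝ) (j l h l' s : ℕ) (hl : l ≠ l') (hlh : l ≠ h) (hl'h : l' ≠ h) (q : ℕ) :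
    SH[atomLaw x T j l h l' h, s, q]
      = atomLaw x T j l h l' h l * 𝟙[q, s + l] + atomLaw x T j l h l' h l' * 𝟙[q, s + l'] + atomLaw x T j l h l' h h * 𝟙[q, s + h] := by
  by_cases hsq : s ≤ q
  · rw [if_pos hsq]
    by_cases e1 : q - s = l
    · rw [e1, if_pos (by omega), if_neg (by omega), if_neg (by omega)]; ring
    by_cases e2 : q - s = l'
    · rw [e2, if_neg (by omega), if_pos (by omega), if_neg (by omega)]; ring
    by_cases e3 : q - s = h
    · rw [e3, if_neg (by omega), if_neg (by omega), if_pos (by omega)]; ring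
    rw [atomLaw_eq_zero x T j l h l' h e1 e3 e2 e3, if_neg (by omega), if_neg (by omega), if_neg (by omega)]; ring
  · rw [if_neg hsq, if_neg (by omega), if_neg (by omega), if_neg (by omega)]; ring

/-- **THE LIGHT SLICE OF A TYPE I ATOM IS THE SIX-CELL LAW OF CENSUS-1's LS-CORE**: for a Type I atom on `{l, l′, h}` (`atomLaw x T₂ j l h l′ h`,
expensive low `l`, cheap low `l′`, one absorber `h`) and a two-point law `{p, m; γ}` on the other side, the light slice
`lconv M₁ M₂ (TP[p,m;γ]) (atom)` is `c₁δ_{p+l} + c₂δ_{p+l′} + c_Pδ_{p+h} + d₁δ_{m+l} + d₂δ_{m+l′} + d_Gδ_{m+h}` with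
`c₁ = (1−γ)m_l`, `c₂ = (1−γ)m_{l′}`, `c_P = (1−γ)m_h`, `d₁ = γm_l`, `d₂ = γm_{l′}`, `d_G = γm_h` — in census-1's parameters `m_l = (1−x)λ`,
`m_{l′} = (1−x)λ′`, `m_h = x`, `λ = (u − c_ℓ)/(c_e − c_ℓ)` (`atomLaw_apply_typeI`).  So census-1 g22's six-cell flow lemma `lsLaw_decAtT_of_flow`
(`…QuantLSCoreFlow`) and its MMG/LMG/LLG cells discharge the Type I instances of `LightSliceCore` through this identity. [this work] -/
theorem lightSlice_typeI_eq_sixCell (x T₂ γ : ℝ) (M₁ M₂ j p m l h l' : ℕ) (hl : l ≠ l') (hlh : l ≠ h) (hl'h : l' ≠ h)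
    (hlM : l ≤ M₂) (hl'M : l' ≤ M₂) (hhM : h ≤ M₂) (hpM : p ≤ M₁) (hmM : m ≤ M₁) :
    lconv M₁ M₂ (fun b => TP[p, m, γ, b]) (atomLaw x T₂ j l h l' h)
      = fun q => (1 - γ) * atomLaw x T₂ j l h l' h l * 𝟙[q, p + l] + (1 - γ) * atomLaw x T₂ j l h l' h l' * 𝟙[q, p + l']
          + (1 - γ) * atomLaw x T₂ j l h l' h h * 𝟙[q, p + h]
          + γ * atomLaw x T₂ j l h l' h l * 𝟙[q, m + l] + γ * atomLaw x T₂ j l h l' h l' * 𝟙[q, m + l']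
          + γ * atomLaw x T₂ j l h l' h h * 𝟙[q, m + h] := by
  have hz : ∀ b, M₂ < b → atomLaw x T₂ j l h l' h b = 0 := fun b hb => atomLaw_eq_zero_of_gt x T₂ j l h l' h hlM hhM hl'M hhM hb
  funext q
  rw [lconv_comm, lconv_TP M₂ M₁ p m _ γ hz hpM hmM, shift_atomLaw_typeI x T₂ j l h l' p hl hlh hl'h q,
    shift_atomLaw_typeI x T₂ j l h l' m hl hlh hl'h q]
  ring

/-- **THE MASSES OF THE SIX-CELL LAW IN CENSUS-1's VARIABLES**: `m_l + m_{l′} = 1 − x` (the tails) and `m_h = x` (the absorber) for a Type I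
atom, with `m_l : m_{l′} = (u − c_ℓ) : (c_e − u)`. [this work] -/
theorem atomLaw_typeI_masses (x T : ℝ) (j l h l' : ℕ) (hx1 : x < 1) (hl : l ≠ l') (hlh : l ≠ h) (hl'h : l' ≠ h)
    (hc : usage x T j l' h < usage x T j l h) :
    atomLaw x T j l h l' h l + atomLaw x T j l h l' h l' = 1 - x ∧ atomLaw x T j l h l' h h = x := by
  obtain ⟨e1, e2, e3⟩ := atomLaw_apply_typeI x T j l h l' hl hlh hl'h
  have h1x : (1 : ℝ) - x ≠ 0 := by linarith
  have hcc : usage x T j l h - usage x T j l' h ≠ 0 := by linarith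
  rw [e1, e2, e3]
  constructor
  · field_simp; ring
  · field_simp; ring

end LawDec

end Quant

end Summit.CriticalPhenomena.PercolationContinuityZ3.Theorems
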